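import Summits.AnomalousDissipation.AnomalousDissipation.Theorems.ConeDesingularisation.Negative.LiouvilleReduction
import Summits.AnomalousDissipation.AnomalousDissipation.Theorems.ConeDesingularisation.Negative.ConeDesingularisationFalseOfSteadyDSolutionLiouvilleProblem
import Literature.Analysis.FluidPDE.SteadyLiouvilleCriteria
import Literature.Analysis.FluidPDE.KNSSThm53OfWindow
import Literature.Analysis.FluidPDE.GigaMiura2011PlanarVorticityLiouvilleHolds
import Literature.Analysis.FluidPDE.AxisymmetricEuler

/-!
# BC5 / T3 witness for `PointSink.ConeDesingularisation` (stmt-AnomalousDissipation-19034 ≡ node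
# `CascadeSoliton`, stmt-19036): the AXISYMMETRIC-NO-SWIRL instance of the crux is DECIDED (refuted)

tribunal-w record (unit `ad-pointsink-w1`, gen 3). The deciding crux of route `PointSink` is, since
`PointFluxCone` is a theorem (`Theorems.PointFluxCone_of`), literally its node `CascadeSoliton`
(`Negative.coneDesingularisation_iff_cascadeSoliton`): a smooth steady unforced unit-viscosity
Navier–Stokes solution `(Q, P)` on `ℝ³` with the `L²`-mass envelope `∫_{B_R}‖Q‖² ≤ C R^{5/3}`,
`0 < ∫|∇Q|² < ∞`, and a non-trivial `(−2/3)`-DSS shell-`L²` far field.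

THE INSTANCE. `CascadeSolitonNoSwirl` := the same object with `Q` axisymmetric about the `x₂`-axis
and swirl-free (`IsAxisymmetric`, `HasNoSwirl`, tree vocabulary of `AxisymmetricEuler`);
`ConeDesingularisationNoSwirl := PointFluxCone → CascadeSolitonNoSwirl` is the corresponding instance
of the crux, and projects onto it (`cascadeSoliton_of_noSwirl`, `coneDesingularisation_of_noSwirl`).

DECIDED — three readings, strongest hypotheses last:
* `not_cascadeSolitonNoSwirl_bounded` — **kernel-only, no literature hypothesis**: there is no
  BOUNDED axisymmetric swirl-free cascade soliton. The Liouville input is Koch–Nadirashvili–Seregin–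
  Šverák 2009, Thm 5.2, which is PROVED in the tree (`KNSS2009_liouville_axisymmetric_no_swirl_holds`):
  a bounded steady classical solution is a bounded ancient weak solution
  (`IsClassicalNSSolutionOn.isBoundedWeakNSSolutionOn_Iio_of_force_annihilates`), hence `Q ≡ b e_z`
  a.e., hence (continuity) constant, so `∇Q ≡ 0`, contradicting `0 < ∫|∇Q|²`.
* `not_cascadeSolitonNoSwirl` — modulo ONE published theorem vendored as a named fact, Galdi 2011
  Thm X.5.1 in the form of Wang 2025 Remark 2.1 (`wang2025_rem21_DSolution_tendsto_const`: every
  `D`-solution tends to some constant vector at infinity, hence is bounded): NO axisymmetric swirl-free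
  cascade soliton at all; equivalently (`coneDesingularisationNoSwirl_false`) the no-swirl instance of
  the crux is FALSE.
* `not_cascadeSolitonNoSwirl_of_KPR` — the same conclusion through the route's own LEVER: the
  `R^{5/3}` envelope pins the limit at infinity to `0` (`Negative.limit_eq_zero_of_envelope`), which is
  exactly the decay hypothesis (0.2) of the Korobkov–Pileckas–Russo 2015 Liouville theorem for
  `D`-solutions without swirl (`KorobkovPileckasRusso2015_liouville_noSwirl`, vendored named fact,
  JMFM 17 (2015) 287–293; Wang 2025 Thm 3.6).
Corollary for provers (`cascadeSoliton_witness_not_noSwirl`): modulo X.5.1 every axisymmetric witness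
of the node HAS SWIRL — the soliton lives in the class where the steady Liouville problem is open
("even for axisymmetric D-solutions", Wang–Yang 2026) and at the exact borderline of every printed
criterion (`|u| ≲ |x|^{-2/3}` ∈ `L^{9/2,∞}`: Galdi X.9.5 needs `L^{9/2}`, Wang 2018 Thm 1.1 needs
`(1+r)^{-μ}`, `μ > 2/3`, KTW 2017 needs `|ω| = o(|x|^{-5/3})` or small `‖u‖_{L^{9/2,∞}}/D^{1/3}`).

T3 READING (why this is a witness of weakness and not of S): the analogue of S = `ZerothLaw` in the
axisymmetric-no-swirl class (anomalous dissipation for swirl-free axisymmetric forced flows) is NOT a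
theorem in scope — the tree's negative route lists it as an untyped special-case crux
(`Theses/Neg.lean`, "symmetry-class catalogue beyond 2½-D (axisymmetric-no-swirl, helical)"), the
tree's 2-D mechanism (`AlexakisDoering*`, `PlanarNoAnomalousDissipation*`) does not cover it, and no
printed statement was found (queries in the g3 memo) — while the C-analogue is decided here.
Nothing in this file asserts a Theses decl positively. [folklore]
-/

noncomputable section

set_option linter.dupNamespace false

open MeasureTheory Filter Topology Set
open Literature.Analysis.FunctionSpaces Literature.Analysis.FluidPDE

namespace Summit.AnomalousDissipation.AnomalousDissipation.Cruxes.ConeDesingularisation.NoSwirlRung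

open Summit.AnomalousDissipation.AnomalousDissipation.Theses.PointSink
  (PointFluxCone ConeDesingularisation CascadeSoliton)
open Summit.AnomalousDissipation.AnomalousDissipation.Theorems (PointFluxCone_of)
open Summit.AnomalousDissipation.AnomalousDissipation.Theorems.ConeDesingularisation.Negative
  (limit_eq_zero_of_envelope isDSolution_of_cascade coneDesingularisation_iff_cascadeSoliton)

/-- Local notation for physical space `ℝ³ = EuclideanSpace ℝ (Fin 3)`. -/
local notation "ℝ³" => EuclideanSpace ℝ (Fin 3)

/-! ## §1 The instance -/

/-- The body of the node `CascadeSoliton` for a given pair `(Q, P)` (verbatim the route decl with the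
two leading existentials stripped). [folklore] -/
def IsCascadeSolitonPair (Q : ℝ³ → ℝ³) (P : ℝ³ → ℝ) : Prop :=
  IsClassicalNSSolutionOn Set.univ 1 (fun _ _ => 0) (fun _ => Q) (fun _ => P) ∧
  (∃ C : ℝ, ∀ R : ℝ, 1 ≤ R → ∫ x in Metric.ball (0 : ℝ³) R, ‖Q x‖ ^ 2 ≤ C * R ^ (5 / 3 : ℝ)) ∧
  Integrable (fun x => frobeniusNormSq (fderiv ℝ Q x)) ∧
  0 < ∫ x, frobeniusNormSq (fderiv ℝ Q x) ∧
  ∃ (lam : ℝ) (V : ℝ³ → ℝ³), 1 < lam ∧ AEStronglyMeasurable V volume ∧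
    (∀ x : ℝ³, x ≠ 0 → V (lam • x) = lam ^ (-(2 / 3 : ℝ)) • V x) ∧
    LocallyIntegrableOn (fun x => ‖V x‖ ^ 2) {x : ℝ³ | x ≠ 0} volume ∧
    0 < ∫ x in {x : ℝ³ | 1 < ‖x‖ ∧ ‖x‖ < lam}, ‖V x‖ ^ 2 ∧
    Tendsto (fun k : ℕ => (lam ^ k) ^ (-(5 / 3 : ℝ)) *
      ∫ x in {x : ℝ³ | lam ^ k < ‖x‖ ∧ ‖x‖ < lam ^ (k + 1)}, ‖Q x - V x‖ ^ 2) atTop (𝓝 0)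

/-- The node is the existence of a cascade-soliton pair (definitional). [folklore] -/
theorem cascadeSoliton_iff_exists_pair : CascadeSoliton ↔ ∃ Q P, IsCascadeSolitonPair Q P :=
  Iff.rfl

/-- **The instance.** An axisymmetric (about the `x₂`-axis) swirl-free cascade soliton. [folklore] -/
def CascadeSolitonNoSwirl : Prop :=
  ∃ (Q : ℝ³ → ℝ³) (P : ℝ³ → ℝ), IsCascadeSolitonPair Q P ∧ IsAxisymmetric Q ∧ HasNoSwirl Q

/-- The same instance with an explicit boundedness clause on the velocity (implied for every
`D`-solution by Galdi's Thm X.5.1, kept explicit for the hypothesis-free kernel theorem). [folklore] -/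
def CascadeSolitonNoSwirlBounded : Prop :=
  ∃ (Q : ℝ³ → ℝ³) (P : ℝ³ → ℝ), IsCascadeSolitonPair Q P ∧ IsAxisymmetric Q ∧ HasNoSwirl Q ∧
    ∃ M : ℝ, ∀ x, ‖Q x‖ ≤ M

/-- The no-swirl instance of the crux `ConeDesingularisation = (PointFluxCone → CascadeSoliton)`. [folklore] -/
def ConeDesingularisationNoSwirl : Prop :=
  PointFluxCone → CascadeSolitonNoSwirl

/-- The instance projects onto the node. [folklore] -/
theorem cascadeSoliton_of_noSwirl (h : CascadeSolitonNoSwirl) : CascadeSoliton := by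
  obtain ⟨Q, P, hQP, -, -⟩ := h
  exact ⟨Q, P, hQP⟩

/-- The instance of the crux projects onto the crux. [folklore] -/
theorem coneDesingularisation_of_noSwirl (h : ConeDesingularisationNoSwirl) : ConeDesingularisation :=
  fun hc => cascadeSoliton_of_noSwirl (h hc)

/-- Since `PointFluxCone` is a theorem, the no-swirl instance of the crux is the no-swirl node. [folklore] -/
theorem coneDesingularisationNoSwirl_iff : ConeDesingularisationNoSwirl ↔ CascadeSolitonNoSwirl :=
  ⟨fun h => h PointFluxCone_of, fun h _ => h⟩

/-! ## §2 Two elementary lemmas -/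

/-- A continuous field with a limit at infinity is bounded. [folklore] -/
theorem exists_bound_of_tendsto_cocompact {Q : ℝ³ → ℝ³} (hQ : Continuous Q) {a : ℝ³}
    (h : Tendsto Q (cocompact ℝ³) (𝓝 a)) : ∃ M : ℝ, ∀ x, ‖Q x‖ ≤ M := by
  have h1 : ∀ᶠ x in cocompact ℝ³, dist (Q x) a < 1 := Metric.tendsto_nhds.mp h 1 one_pos
  obtain ⟨t, ht, hts⟩ := mem_cocompact.mp h1
  obtain ⟨C, hC⟩ := ht.exists_bound_of_continuousOn hQ.continuousOn
  refine ⟨max C (‖a‖ + 1), fun x => ?_⟩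
  by_cases hx : x ∈ t
  · exact (hC x hx).trans (le_max_left _ _)
  · have hd : dist (Q x) a < 1 := hts hx
    rw [dist_eq_norm] at hd
    have : ‖Q x‖ ≤ ‖a‖ + ‖Q x - a‖ := norm_le_insert' (Q x) a
    exact le_trans (by linarith) (le_max_right _ _)

/-- A constant field has zero Dirichlet integrand. [folklore] -/
theorem frobeniusNormSq_fderiv_const (c : ℝ³) (x : ℝ³) :
    frobeniusNormSq (fderiv ℝ (fun _ : ℝ³ => c) x) = 0 := by
  simp [frobeniusNormSq_zero]

/-! ## §3 The kernel theorem: no BOUNDED swirl-free cascade soliton (KNSS Thm 5.2, proved in tree) -/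

/-- **No bounded axisymmetric swirl-free cascade soliton — hypothesis-free.** A bounded steady
classical unforced solution is a bounded ancient weak solution on `ℝ³ × (−∞, 0)`; by KNSS 2009
Thm 5.2 (tree theorem `KNSS2009_liouville_axisymmetric_no_swirl_holds`) it is `b(t) e_z` a.e., hence
— being continuous and time-independent — a constant field, so `∇Q ≡ 0`, contradicting the positive
dissipation clause of the node. [folklore] -/
theorem not_cascadeSolitonNoSwirl_bounded : ¬ CascadeSolitonNoSwirlBounded := by
  rintro ⟨Q, P, ⟨hNS, -, -, hpos, -⟩, hax, hns, M, hM⟩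
  have hQs : ContDiff ℝ (⊤ : ℕ∞) Q := hNS.contDiff_velocity (mem_univ (0 : ℝ))
  have hQc : Continuous Q := hQs.continuous
  -- restrict the steady solution to the ancient time interval `(−∞, 0)`
  have hNS' : IsClassicalNSSolutionOn (Iio (0 : ℝ)) 1 (fun _ _ => (0 : ℝ³)) (fun _ => Q) (fun _ => P) :=
    hNS.mono (subset_univ _) (uniqueDiffOn_Iio 0)
  have hbdd : IsBoundedOn (Iio (0 : ℝ)) (fun _ : ℝ => Q) := ⟨M, fun _ _ x => hM x⟩
  have hweak : IsBoundedWeakNSSolutionOn (Iio (0 : ℝ)) isOpen_Iio 1 (fun _ : ℝ => Q) :=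
    hNS'.isBoundedWeakNSSolutionOn_Iio_of_force_annihilates hbdd
      (fun _ _ φ _ _ _ => by simp)
  have hax' : ∀ θ : ℝ, ∀ᵐ t ∂(volume.restrict (Iio (0 : ℝ))),
      (fun x => (fun _ : ℝ => Q) t (rotZ θ x)) =ᵐ[volume] fun x => rotZ θ ((fun _ : ℝ => Q) t x) :=
    fun θ => Eventually.of_forall fun _ => Eventually.of_forall fun x => hax θ x
  have hns' : ∀ᵐ t ∂(volume.restrict (Iio (0 : ℝ))),
      swirl ((fun _ : ℝ => Q) t) =ᵐ[volume] (0 : ℝ³ → ℝ) :=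
    Eventually.of_forall fun _ => Eventually.of_forall fun x => hns x
  obtain ⟨b, -, -, hb⟩ := KNSS2009_liouville_axisymmetric_no_swirl_holds hweak hax' hns'
  -- pick one time: `Q = b t • e_z` a.e., hence everywhere by continuity
  have hne : (volume.restrict (Iio (0 : ℝ))) ≠ 0 := by
    intro h0
    have h1 : (volume.restrict (Iio (0 : ℝ))) (Iio 0) = 0 := by rw [h0]; rfl
    rw [Measure.restrict_apply_self, Real.volume_Iio] at h1
    exact ENNReal.top_ne_zero h1
  haveI : (ae (volume.restrict (Iio (0 : ℝ)))).NeBot := ae_neBot.mpr hne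
  obtain ⟨t, ht⟩ := hb.exists
  have hQeq : Q = fun _ => b t • eZ :=
    (Continuous.ae_eq_iff_eq volume hQc continuous_const).mp ht
  subst hQeq
  simp at hpos

/-! ## §4 Modulo Galdi X.5.1 (Wang 2025, Remark 2.1): no swirl-free cascade soliton at all -/

/-- **The no-swirl instance of the node is FALSE**, modulo the single published fact
`wang2025_rem21_DSolution_tendsto_const` (Galdi 2011 Thm X.5.1 / Wang 2025 Remark 2.1: a
`D`-solution tends to some constant at infinity): the soliton is a `D`-solution
(`Negative.isDSolution_of_cascade`), hence bounded, and §3 applies. [folklore] -/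
theorem not_cascadeSolitonNoSwirl (hrem : wang2025_rem21_DSolution_tendsto_const) :
    ¬ CascadeSolitonNoSwirl := by
  rintro ⟨Q, P, hQP, hax, hns⟩
  have hNS := hQP.1
  have hInt := hQP.2.2.1
  have hQs : ContDiff ℝ (⊤ : ℕ∞) Q := hNS.contDiff_velocity (mem_univ (0 : ℝ))
  obtain ⟨u₀, hu₀⟩ := hrem Q P (isDSolution_of_cascade hNS hInt)
  obtain ⟨M, hM⟩ := exists_bound_of_tendsto_cocompact hQs.continuous hu₀
  exact not_cascadeSolitonNoSwirl_bounded ⟨Q, P, hQP, hax, hns, M, hM⟩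

/-- **The no-swirl instance of the crux is FALSE** (modulo X.5.1): `PointFluxCone` holds
(`PointFluxCone_of`) and there is no swirl-free cascade soliton. [folklore] -/
theorem coneDesingularisationNoSwirl_false (hrem : wang2025_rem21_DSolution_tendsto_const) :
    ¬ ConeDesingularisationNoSwirl := fun h =>
  not_cascadeSolitonNoSwirl hrem (h PointFluxCone_of)

/-- **Reading for provers of the node**: modulo X.5.1, every axisymmetric cascade soliton HAS SWIRL. [folklore] -/
theorem cascadeSoliton_witness_not_noSwirl (hrem : wang2025_rem21_DSolution_tendsto_const)
    {Q : ℝ³ → ℝ³} {P : ℝ³ → ℝ} (h : IsCascadeSolitonPair Q P) (hax : IsAxisymmetric Q) :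
    ¬ HasNoSwirl Q := fun hns =>
  not_cascadeSolitonNoSwirl hrem ⟨Q, P, h, hax, hns⟩

/-! ## §5 The same through the route's lever: envelope ⇒ decay ⇒ Korobkov–Pileckas–Russo 2015 -/

/-- **Via the `R^{5/3}` envelope and KPR 2015.** Modulo the two published facts
`KorobkovPileckasRusso2015_liouville_noSwirl` (Liouville for `D`-solutions without swirl that tend to
`0`) and `wang2025_rem21_DSolution_tendsto_const` (X.5.1), there is no swirl-free cascade soliton: the
soliton tends to a constant, the ENVELOPE pins the constant to `0` (`limit_eq_zero_of_envelope`),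
KPR gives `Q ≡ 0`, contradicting `0 < ∫|∇Q|²`. This is `Negative.not_cascadeSoliton_of_liouville` with
the OPEN Liouville conjecture replaced by its PROVED no-swirl case. [folklore] -/
theorem not_cascadeSolitonNoSwirl_of_KPR (hKPR : KorobkovPileckasRusso2015_liouville_noSwirl)
    (hrem : wang2025_rem21_DSolution_tendsto_const) : ¬ CascadeSolitonNoSwirl := by
  rintro ⟨Q, P, ⟨hNS, ⟨C, hC⟩, hInt, hpos, -⟩, hax, hns⟩
  have hprof : IsLerayProfile 1 0 Q P := hNS.isLerayProfile_zero_of_steady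
  have hD : IsDSolution 1 0 Q P := isDSolution_of_cascade hNS hInt
  obtain ⟨u₀, hu₀⟩ := hrem Q P hD
  have hQs : ContDiff ℝ (⊤ : ℕ∞) Q := hNS.contDiff_velocity (mem_univ (0 : ℝ))
  have hu0 : u₀ = 0 := limit_eq_zero_of_envelope hQs.continuous hC hu₀
  subst hu0
  have hQ0 : Q = 0 := hKPR 1 one_pos Q P hprof hax hns hD.2 hu₀
  subst hQ0
  simp [frobeniusNormSq_zero] at hpos

/-- The rung in the name the brief asks for: the no-swirl instance of `ConeDesingularisation` is
decided (FALSE) modulo Galdi X.5.1. [folklore] -/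
theorem ConeDesingularisation_rung_noSwirl (hrem : wang2025_rem21_DSolution_tendsto_const) :
    PointFluxCone ∧ ¬ CascadeSolitonNoSwirl ∧ ¬ ConeDesingularisationNoSwirl :=
  ⟨PointFluxCone_of, not_cascadeSolitonNoSwirl hrem, coneDesingularisationNoSwirl_false hrem⟩

end Summit.AnomalousDissipation.AnomalousDissipation.Cruxes.ConeDesingularisation.NoSwirlRung

end
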